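import Literature.Computability.AlgebraicComplexity.BDS24ExponentialInterpolation
import Summits.ValiantsHypothesis.ValiantsHypothesis.Theorems.VPBoundarySquareRootsNewtonCore
import Summits.ValiantsHypothesis.ValiantsHypothesis.Theorems.VPBoundarySquarePresentableConstants
import HarnessLib

/-!
# Roots are presentable — Bürgisser's root lifting in BDS's presentable model (E1 / S3)

Helper file for route `VPBoundarySquare` (series O-L3-12). MAIN RESULT
(`presBorderComplexity_le_of_factorization`): at a good point — `H = (y - φ)^{e+1} · Q` in
`F[x][y]`, `Q(x, φ)(0) ≠ 0` — the PRESENTABLE border complexity `L_ε(φ)` (BDS 2024 Def. 4.3: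
`ε` a circuit input, constants in `F`; tree `presBorderComplexity`) is at most an explicit
polynomial in `deg φ`, `L(H)`, `#β`, INDEPENDENT of `deg H` and of the multiplicity (Bürgisser
2004 Thm 1.3 / BDS 2024 Lemma 4.4 in root form; one currency above the tree's
`borderComplexity_le_of_isRoot`, whose constants range over `F((ε))`). Mechanism: the engine
`polyOrdGE_one_newtonLagrange` (S2's data-explicit Newton core + S1's pole calculus and
Lagrange `ε`-rescaling instead of a degree truncation) is ONE circuit over `F` whose constants
`ε, ξ⁻¹, c₀ = H(0, c + ε), ε^m, ℓ_j` are quotients `a_k(ε)/b(ε)` of small circuits in `F[ε]`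
(`ξ = ∂_y H(0, c + ε)` via S1's degree-free Baur–Strassen bound; `ε^m`, `m = 2^μ`, by repeated
squaring); g35's `presBorderComplexity_le_of_ratReading` clears the one denominator.
[cite: Burgisser2004Factors, Thm. 1.3, Prop. 3.4; BhargavDwivediSaxena2024, Def. 4.3, Lemma 4.4]
-/
noncomputable section

set_option linter.dupNamespace false

namespace Summit.ValiantsHypothesis.ValiantsHypothesis.Theorems.VPBoundarySquareRootsPresentable

open MvPolynomial Finset Literature.Computability.AlgebraicComplexity
open Literature.Computability.AlgebraicComplexity.ArithCircuit
open Summit.ValiantsHypothesis.ValiantsHypothesis.Theorems.VPBoundarySquareRootsToolbox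
open Summit.ValiantsHypothesis.ValiantsHypothesis.Theorems.VPBoundarySquareRootsNewtonCore
open Summit.ValiantsHypothesis.ValiantsHypothesis.Theorems.VPBoundarySquarePresentableConstants

universe u v

section Cost
variable {k : Type u} [CommSemiring k] {σ : Type v}

/-- `L(p + q) ≤ L(p) + L(q) + 1`, bound form. [cite: Burgisser2000, §2.1] -/
private theorem cx_add {p q : MvPolynomial σ k} {a b : ℕ} (hp : complexity p ≤ a)
    (hq : complexity q ≤ b) : complexity (p + q) ≤ a + b + 1 :=
  (complexity_add_le_holds p q).trans (by omega)

/-- `L(p · q) ≤ L(p) + L(q) + 1`, bound form. [cite: Burgisser2000, §2.1] -/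
private theorem cx_mul {p q : MvPolynomial σ k} {a b : ℕ} (hp : complexity p ≤ a)
    (hq : complexity q ≤ b) : complexity (p * q) ≤ a + b + 1 :=
  (complexity_mul_le_holds p q).trans (by omega)

/-- Inputs are free. [cite: Burgisser2000, §2.1] -/
private theorem cx_X (v : σ) : complexity (X v : MvPolynomial σ k) ≤ 0 := (complexity_X_holds v).le
/-- Constants are free. [cite: Burgisser2000, §2.1] -/
private theorem cx_C (c : k) : complexity (C c : MvPolynomial σ k) ≤ 0 := (complexity_C_holds c).le
/-- Inputs are free (summed form). [cite: Burgisser2000, §2.1] -/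
private theorem sum_cx_X [Fintype σ] : ∑ v : σ, complexity (X v : MvPolynomial σ k) = 0 :=
  Finset.sum_eq_zero fun v _ => complexity_X_holds v

/-- `L(x^e) ≤ e`. [folklore] -/
private theorem cx_X_pow (e : ℕ) : complexity (X () ^ e : MvPolynomial Unit k) ≤ e := by
  induction e with
  | zero => rw [pow_zero, ← C_1]; exact cx_C _
  | succ e ih => rw [pow_succ]; exact (cx_mul ih (cx_X _)).trans (by omega)

/-- `L(p^e) ≤ L(p) + e` (compute `p` once). [cite: Burgisser2000, §2.1] -/
private theorem cx_pow (p : MvPolynomial σ k) (e : ℕ) :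
    complexity (p ^ e) ≤ complexity p + e := by
  have h := complexity_aeval_le (X () ^ e : MvPolynomial Unit k) (fun _ => p)
  simp only [map_pow, aeval_X, Finset.sum_const, Finset.card_univ, Fintype.card_unit,
    smul_eq_mul, one_mul] at h
  have h' := cx_X_pow (k := k) e
  omega

/-- Repeated squaring: `L(x^(2^μ)) ≤ 2μ`. [folklore] -/
private theorem cx_X_pow_two_pow (v : σ) (μ : ℕ) :
    complexity (X v ^ 2 ^ μ : MvPolynomial σ k) ≤ 2 * μ := by
  induction μ with
  | zero => rw [pow_zero, pow_one]; exact (cx_X v).trans (Nat.zero_le _)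
  | succ μ ih => rw [pow_succ, pow_mul]; exact (cx_pow _ 2).trans (by omega)

end Cost

section Main
variable {F : Type u} [Field F] {β : Type v}

/-- `a ε^m = a · ε^m` in `F((ε))`. [folklore] -/
private theorem single_eq_C_mul_pow (m : ℕ) (a : F) : HahnSeries.single (m : ℤ) a =
    HahnSeries.C a * HahnSeries.single (1 : ℤ) (1 : F) ^ m := by
  rw [HahnSeries.single_pow, HahnSeries.C_apply, HahnSeries.single_mul_single]; simp

/-- **Newton–Lagrange engine.** At a good point (`H = (y - φ)^{e+1} Q`, `Q(x, φ)(0) ≠ 0`), with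
`c = φ(0)`, `c₀ = H(0, c + ε)`, the exact slope `ξ = ∂_y H(0, c + ε)`, any `D ≥ deg_y H`,
`m > e (D+1)^d`, distinct `λ_0, …, λ_d ∈ F`, `t_j = λ_j ε^m` and the Lagrange weights
`ℓ_j = ∏_{i ≠ j} (1 - t_i)/(t_j - t_i)`: the combination `Σ_j ℓ_j · z_d(t_j x)` of rescaled
copies of the `d`-th Newton iterate `z_d` (`z ↦ z - ξ⁻¹ (H(x, z + ε) - c₀)` from `c`) is
`φ + O(ε)` — no truncation. [cite: Burgisser2004Factors, Prop. 3.4;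
BhargavDwivediSaxena2024, Lemma 4.4] -/
theorem polyOrdGE_one_newtonLagrange [CharZero F] (H : MvPolynomial (Option β) F)
    (φ : MvPolynomial β F) {e : ℕ} (Q : Polynomial (MvPolynomial β F))
    (hfac : optionEquivLeft F β H = (Polynomial.X - Polynomial.C φ) ^ (e + 1) * Q)
    (hq : coeff 0 (Q.eval φ) ≠ 0) {d : ℕ} (hd : φ.totalDegree ≤ d) {D : ℕ}
    (hD : (optionEquivLeft F β H).natDegree ≤ D) {m : ℕ} (hm : e * (D + 1) ^ d + 1 ≤ m)
    (lam : Fin (d + 1) → F) (hlam : Function.Injective lam)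
    {ε c₀ ξ : LaurentSeries F} {t ℓ : Fin (d + 1) → LaurentSeries F}
    (hε : ε = HahnSeries.single 1 1)
    (hc₀ : c₀ = aeval (fun o : Option β =>
      o.elim (algebraMap F (LaurentSeries F) (coeff 0 φ) + ε) (fun _ => 0)) H)
    (hξ : ξ = aeval (fun o : Option β =>
      o.elim (algebraMap F (LaurentSeries F) (coeff 0 φ) + ε) (fun _ => 0)) (pderiv none H))
    (ht : ∀ j, t j = HahnSeries.single (m : ℤ) (lam j))
    (hℓ : ∀ j, ℓ j = ∏ i ∈ univ.erase j, (1 - t i) / (t j - t i)) :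
    ξ ≠ 0 ∧ PolyOrdGE 1 (∑ j, C (ℓ j) * aeval (fun x : β => C (t j) * X x)
        ((fun z => z - C ξ⁻¹ * (aeval (fun o : Option β => o.elim (z + C ε) X)
            (MvPolynomial.map (algebraMap F (LaurentSeries F)) H) - C c₀))^[d]
          (C (algebraMap F (LaurentSeries F) (coeff 0 φ)))) -
      MvPolynomial.map (algebraMap F (LaurentSeries F)) φ) := by
  classical
  obtain ⟨hξ0, hξinv, hcore⟩ := newton_truncation_polyOrdGE H φ Q hfac hq hd hε hc₀ hξ
  obtain ⟨PG, hPG0, hPGdeg, hPGev⟩ := exists_perturbedPolynomial H (coeff 0 φ) hε hc₀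
  have hPGev' : ∀ z, aeval (fun o : Option β => o.elim (z + C ε) X)
      (MvPolynomial.map (algebraMap F (LaurentSeries F)) H) - C c₀ = PG.eval z :=
    fun z => (hPGev z).symm
  simp only [hPGev'] at hcore ⊢
  have hc : IsOrdGE 0 (algebraMap F (LaurentSeries F) (coeff 0 φ)) := by
    rw [algebraMap_laurentSeries_apply]; exact IsOrdGE.C _
  have hz := polyOrdGE_newton_iterate_pole hPG0 (hPGdeg.trans hD) hξinv hc d
  have h := (polyOrdGE_lagrangeRescale_sub_truncation _ hz hm lam hlam ht hℓ).add hcore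
  rw [sub_add_sub_cancel] at h
  exact ⟨hξ0, h⟩

/-- **Roots are presentable — Bürgisser 2004 Thm 1.3 / BDS 2024 Lemma 4.4 in root form, at a
good point.** If `H = (y - φ)^{e+1} · Q` in `F[x_β][y]` with `Q(x, φ)(0) ≠ 0` (`char F = 0`),
`d ≥ deg φ`, `μ ≥ (L(H) + 1)(d + 1)` and `Ξ ≥ 4 (3 L(H) + #β + 2)² + 1`, then
`L_ε(φ) ≤ 2 (3 (d+1)(d (L(H) + 6) + 2 #β + 2) + 2)² + 5 (L(H) + 4μ + d + Ξ + 5)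
  + (d+1)(d (2μ + 3) + Ξ + 3)` in BDS's presentable model — polynomial in `d, L(H), #β`,
independent of `deg H` and `e`. [cite: Burgisser2004Factors, Thm. 1.3, Prop. 3.4;
BhargavDwivediSaxena2024, Def. 4.3, Lemma 4.4] -/
theorem presBorderComplexity_le_of_factorization [CharZero F] [Fintype β]
    (H : MvPolynomial (Option β) F) (φ : MvPolynomial β F) {e : ℕ}
    (Q : Polynomial (MvPolynomial β F))
    (hfac : optionEquivLeft F β H = (Polynomial.X - Polynomial.C φ) ^ (e + 1) * Q)
    (hq : coeff 0 (Q.eval φ) ≠ 0) {d : ℕ} (hd : φ.totalDegree ≤ d) {μ Ξ : ℕ}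
    (hμ : (complexity H + 1) * (d + 1) ≤ μ)
    (hΞ : 4 * (3 * complexity H + Fintype.card β + 2) ^ 2 + 1 ≤ Ξ) :
    presBorderComplexity φ ≤
      2 * (3 * ((d + 1) * (d * (complexity H + 6) + 2 * Fintype.card β + 2)) + 2) ^ 2 +
        5 * (complexity H + 4 * μ + d + Ξ + 5) + (d + 1) * (d * (2 * μ + 3) + Ξ + 3) := by
  classical
  -- (0) data: `ε`, `c₀ = H(0, c + ε)`, `ξ = ∂_y H(0, c + ε)`, `λ_j = j`, `t_j = λ_j ε^(2^μ)`, `ℓ_j`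
  set ε : LaurentSeries F := HahnSeries.single (1 : ℤ) (1 : F) with hε
  set c₀ : LaurentSeries F := aeval (fun o : Option β =>
    o.elim (algebraMap F (LaurentSeries F) (coeff 0 φ) + ε) (fun _ => 0)) H with hc₀
  set ξ : LaurentSeries F := aeval (fun o : Option β =>
    o.elim (algebraMap F (LaurentSeries F) (coeff 0 φ) + ε) (fun _ => 0)) (pderiv none H)
    with hξ
  set lam : Fin (d + 1) → F := fun j => ((j : ℕ) : F) with hlam
  have hlam_inj : Function.Injective lam := fun i j h => Fin.ext (Nat.cast_injective h)
  set t : Fin (d + 1) → LaurentSeries F := fun j => HahnSeries.single ((2 ^ μ : ℕ) : ℤ) (lam j)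
    with ht
  set ℓ : Fin (d + 1) → LaurentSeries F := fun j => ∏ i ∈ univ.erase j, (1 - t i) / (t j - t i)
    with hℓ
  have hεne : ε ≠ 0 := HahnSeries.single_ne_zero one_ne_zero
  -- (1) the engine, with `D = deg_y H ≥ e + 1` and `m = 2^μ > e (D+1)^d`
  have hQ0 : Q ≠ 0 := by rintro rfl; simp at hq
  have heD : e + 1 ≤ (optionEquivLeft F β H).natDegree := by
    rw [hfac, Polynomial.natDegree_mul (pow_ne_zero _ (Polynomial.X_sub_C_ne_zero φ)) hQ0,
      Polynomial.natDegree_pow, Polynomial.natDegree_X_sub_C, mul_one]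
    exact Nat.le_add_right _ _
  have hD2 : (optionEquivLeft F β H).natDegree + 1 ≤ 2 ^ (complexity H + 1) := by
    have h := degreeOf_none_le_two_pow_complexity H
    have h1 : 1 ≤ 2 ^ complexity H := Nat.one_le_two_pow
    rw [← natDegree_optionEquivLeft] at h; rw [pow_succ]; omega
  have hm : e * ((optionEquivLeft F β H).natDegree + 1) ^ d + 1 ≤ 2 ^ μ :=
    calc e * ((optionEquivLeft F β H).natDegree + 1) ^ d + 1
        ≤ (optionEquivLeft F β H).natDegree * ((optionEquivLeft F β H).natDegree + 1) ^ d +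
            ((optionEquivLeft F β H).natDegree + 1) ^ d :=
          add_le_add (Nat.mul_le_mul_right _ (by omega)) (Nat.one_le_pow' _ _)
      _ = ((optionEquivLeft F β H).natDegree + 1) ^ (d + 1) := by ring
      _ ≤ (2 ^ (complexity H + 1)) ^ (d + 1) := Nat.pow_le_pow_left hD2 _
      _ ≤ 2 ^ μ := by rw [← pow_mul]; exact Nat.pow_le_pow_right (by norm_num) hμ
  obtain ⟨hξ0, hmain⟩ := polyOrdGE_one_newtonLagrange H φ Q hfac hq hd le_rfl hm lam hlam_inj
    (ε := ε) (c₀ := c₀) (ξ := ξ) (t := t) (ℓ := ℓ) rfl rfl rfl (fun _ => rfl) (fun _ => rfl)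
  -- (2) readings `a_k / b ∈ F(ε)` of the slots `ε`, `ξ⁻¹`, `c₀`, `ε^m`, `ℓ_j` (nested `Option`)
  set rd : MvPolynomial Unit F →ₐ[F] LaurentSeries F := aeval fun _ : Unit => ε with hrd
  set gF : Option β → MvPolynomial Unit F := fun o => o.elim (C (coeff 0 φ) + X ()) fun _ => 0
    with hgF
  set ξF : MvPolynomial Unit F := aeval gF (pderiv none H) with hξF
  set cF : MvPolynomial Unit F := aeval gF H with hcF
  set Xm : MvPolynomial Unit F := X () ^ 2 ^ μ with hXm
  set Pd : MvPolynomial Unit F := Xm ^ d with hPd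
  set π : Fin (d + 1) → F := fun j => ∏ i ∈ univ.erase j, (lam j - lam i) with hπ
  set a : Option (Option (Option (Option (Fin (d + 1))))) → MvPolynomial Unit F := fun k =>
    k.elim (X () * Pd * ξF) fun k => k.elim Pd fun k => k.elim (cF * Pd * ξF) fun k =>
      k.elim (Xm * Pd * ξF) fun j =>
        C (π j)⁻¹ * (∏ i ∈ univ.erase j, (C 1 + C (-lam i) * Xm)) * ξF with ha
  set den : MvPolynomial Unit F := ξF * Pd with hden
  have hrdX : rd (X ()) = ε := by rw [hrd]; exact aeval_X _ _
  have hrdC : ∀ r, rd (C r) = algebraMap F (LaurentSeries F) r := fun r => by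
    rw [hrd]; exact aeval_C _ r
  have hrdgF : ∀ o, rd (gF o) = Option.elim o (algebraMap F (LaurentSeries F) (coeff 0 φ) + ε)
      (fun _ => 0) := fun o => by cases o <;> simp [hgF, hrdX, hrdC]
  have hrdξ : rd ξF = ξ := by rw [hξ, hξF, comp_aeval_apply]; simp only [hrdgF]
  have hrdc : rd cF = c₀ := by rw [hc₀, hcF, comp_aeval_apply]; simp only [hrdgF]
  have hrdXm : rd Xm = ε ^ 2 ^ μ := by rw [hXm, map_pow, hrdX]
  have hrdPd : rd Pd = (ε ^ 2 ^ μ) ^ d := by rw [hPd, map_pow, hrdXm]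
  have hεmd : (ε ^ 2 ^ μ) ^ d ≠ 0 := pow_ne_zero _ (pow_ne_zero _ hεne)
  have hrdden : rd den = ξ * (ε ^ 2 ^ μ) ^ d := by rw [hden, map_mul, hrdξ, hrdPd]
  have hdenK : ξ * (ε ^ 2 ^ μ) ^ d ≠ 0 := mul_ne_zero hξ0 hεmd
  have hden0 : den ≠ 0 := fun h => hdenK (by rw [← hrdden, h, map_zero])
  have htε : ∀ i, t i = algebraMap F (LaurentSeries F) (lam i) * ε ^ 2 ^ μ := fun i => by
    show HahnSeries.single _ (lam i) = _
    rw [single_eq_C_mul_pow, algebraMap_laurentSeries_apply]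
  have hr0 : rd (a none) / rd den = ε := by
    show rd (X () * Pd * ξF) / rd den = ε
    rw [map_mul, map_mul, hrdX, hrdPd, hrdξ, hrdden, div_eq_iff hdenK]; ring
  have hr1 : rd (a (some none)) / rd den = ξ⁻¹ := by
    show rd Pd / rd den = ξ⁻¹
    rw [hrdPd, hrdden, div_eq_iff hdenK, ← mul_assoc, inv_mul_cancel₀ hξ0, one_mul]
  have hr2 : rd (a (some (some none))) / rd den = c₀ := by
    show rd (cF * Pd * ξF) / rd den = c₀
    rw [map_mul, map_mul, hrdc, hrdPd, hrdξ, hrdden, div_eq_iff hdenK]; ring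
  have hr3 : rd (a (some (some (some none)))) / rd den = ε ^ 2 ^ μ := by
    show rd (Xm * Pd * ξF) / rd den = ε ^ 2 ^ μ
    rw [map_mul, map_mul, hrdXm, hrdPd, hrdξ, hrdden, div_eq_iff hdenK]; ring
  have hrℓ : ∀ j, rd (a (some (some (some (some j))))) / rd den = ℓ j := fun j => by
    have hπ0 : π j ≠ 0 := Finset.prod_ne_zero_iff.mpr fun i hi =>
      sub_ne_zero.mpr fun h => Finset.ne_of_mem_erase hi (hlam_inj h).symm
    have hιπ : algebraMap F (LaurentSeries F) (π j) ≠ 0 := (map_ne_zero _).mpr hπ0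
    have hπK : algebraMap F (LaurentSeries F) (π j) = ∏ i ∈ univ.erase j,
        (algebraMap F (LaurentSeries F) (lam j) - algebraMap F (LaurentSeries F) (lam i)) := by
      simp only [hπ, map_prod, map_sub]
    have hnum : rd (a (some (some (some (some j))))) =
        (algebraMap F (LaurentSeries F) (π j))⁻¹ * (∏ i ∈ univ.erase j,
          (1 - algebraMap F (LaurentSeries F) (lam i) * ε ^ 2 ^ μ)) * ξ := by
      show rd (C (π j)⁻¹ * (∏ i ∈ univ.erase j, (C 1 + C (-lam i) * Xm)) * ξF) = _
      rw [map_mul, map_mul, map_prod, hrdξ, hrdC, map_inv₀]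
      simp only [map_sub, map_mul, hrdC, map_one, map_neg, hrdXm, neg_mul, ← sub_eq_add_neg]
    have hℓj : ℓ j = (∏ i ∈ univ.erase j,
        (1 - algebraMap F (LaurentSeries F) (lam i) * ε ^ 2 ^ μ)) /
          (algebraMap F (LaurentSeries F) (π j) * (ε ^ 2 ^ μ) ^ d) := by
      show (∏ i ∈ univ.erase j, (1 - t i) / (t j - t i)) = _
      simp only [htε, Finset.prod_div_distrib, ← sub_mul]
      rw [Finset.prod_mul_distrib, Finset.prod_const, Finset.card_erase_of_mem (mem_univ j),
        Finset.card_univ, Fintype.card_fin, Nat.add_sub_cancel, hπK]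
    rw [hnum, hrdden, hℓj, div_eq_div_iff hdenK (mul_ne_zero hιπ hεmd)]
    linear_combination ((∏ i ∈ univ.erase j,
      (1 - algebraMap F (LaurentSeries F) (lam i) * ε ^ 2 ^ μ)) * ξ * (ε ^ 2 ^ μ) ^ d) *
      inv_mul_cancel₀ hιπ
  -- (3) the symbolic Newton–Lagrange circuit `E ∈ F[x_β, slots]`
  set g : Option β → MvPolynomial (Option (β ⊕ Option (Option (Option (Option (Fin (d + 1)))))))
      F := fun o => o.elim (X none + X (some (Sum.inr none))) fun x => X (some (Sum.inl x))
    with hg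
  set S := X none + C (-1 : F) * (X (some (Sum.inr (some none))) *
    (aeval g H + C (-1 : F) * X (some (Sum.inr (some (some none)))))) with hS
  set N := fun z : MvPolynomial (β ⊕ Option (Option (Option (Option (Fin (d + 1)))))) F =>
    aeval (fun o => Option.elim o z X) S with hN
  set zs := N^[d] (C (coeff 0 φ)) with hzs
  set sub := fun (j : Fin (d + 1)) => Sum.elim
    (fun x : β => C (lam j) * (X (Sum.inr (some (some (some none)))) * X (Sum.inl x)))
    fun k : Option (Option (Option (Option (Fin (d + 1))))) => X (Sum.inr k) with hsub
  set E := ∑ j, X (Sum.inr (some (some (some (some j))))) * aeval (sub j) zs with hE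
  -- (4) its evaluation at the readings is the engine's expression
  set ev := aeval (R := F) (Sum.elim (X : β → MvPolynomial β (LaurentSeries F))
    fun k => C (rd (a k) / rd den)) with hev
  have hevX : ∀ v, ev (X v) = Sum.elim X (fun k => C (rd (a k) / rd den)) v := fun v => by
    rw [hev]; exact aeval_X _ v
  have hevC : ∀ r, ev (C r) = C (algebraMap F (LaurentSeries F) r) := fun r => by
    rw [hev, aeval_C, MvPolynomial.algebraMap_apply]
  have hE1 : Function.Semiconj ev N (fun z => z - C ξ⁻¹ *
      (aeval (fun o : Option β => o.elim (z + C ε) X)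
        (MvPolynomial.map (algebraMap F (LaurentSeries F)) H) - C c₀)) := by
    intro z
    have hθ : ∀ o : Option β,
        aeval (fun i => ev (Option.elim i z X)) (g o) = o.elim (ev z + C ε) X := fun o => by
      cases o <;> simp [hg, hevX, hr0]
    show ev (aeval (fun o => Option.elim o z X) S) = _
    rw [comp_aeval_apply, hS]
    simp only [map_add, map_mul, map_neg, map_one, aeval_X, Option.elim_none, Option.elim_some,
      comp_aeval_apply, hθ, hevX, Sum.elim_inr, hr1, hr2, aeval_map_algebraMap]
    ring
  have hE2 : ev zs = (fun z => z - C ξ⁻¹ *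
      (aeval (fun o : Option β => o.elim (z + C ε) X)
        (MvPolynomial.map (algebraMap F (LaurentSeries F)) H) - C c₀))^[d]
      (C (algebraMap F (LaurentSeries F) (coeff 0 φ))) := by
    rw [hzs, ← hevC]; exact hE1.iterate_right d (C (coeff 0 φ))
  have htj : ∀ j v, ev (sub j v) =
      aeval (fun x : β => C (t j) * X x) ((Sum.elim X fun k => C (rd (a k) / rd den)) v) := by
    intro j v
    rcases v with x | k
    · simp only [hsub, Sum.elim_inl, Sum.elim_inr, map_mul, hevC, hevX, hr3, aeval_X, htε]
      ring
    · simp [hsub, hevX]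
  have hcomp : ∀ j p, aeval (fun v => aeval (fun x : β => C (t j) * X x)
      ((Sum.elim X fun k => C (rd (a k) / rd den)) v)) p =
      aeval (fun x : β => C (t j) * X x) (ev p) := fun j p => by
    rw [hev]
    exact (comp_aeval_apply (Sum.elim X fun k => C (rd (a k) / rd den))
      ((aeval fun x : β => C (t j) * X x).restrictScalars F) p).symm
  have hE3 : ev E = ∑ j, C (ℓ j) * aeval (fun x : β => C (t j) * X x)
      ((fun z => z - C ξ⁻¹ * (aeval (fun o : Option β => o.elim (z + C ε) X)
          (MvPolynomial.map (algebraMap F (LaurentSeries F)) H) - C c₀))^[d]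
        (C (algebraMap F (LaurentSeries F) (coeff 0 φ)))) := by
    rw [hE, map_sum]
    refine Finset.sum_congr rfl fun j _ => ?_
    simp only [map_mul, hevX, Sum.elim_inr, hrℓ, comp_aeval_apply, htj, hcomp, hE2]
  have hP : PolyOrdGE 1 (ev E - MvPolynomial.map (algebraMap F (LaurentSeries F)) φ) := by
    rw [hE3]; exact hmain
  have hstar := presBorderComplexity_le_of_ratReading E a hden0 φ hP
  -- (5) costs: the circuit `E`, the readings `a_k`, `b`; total
  have hgc : ∑ o : Option β, complexity (g o) ≤ 1 := by
    have h1 : ∀ x : β, complexity (g (some x)) = 0 := fun x => complexity_X_holds _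
    rw [Fintype.sum_option]; simp only [h1, Finset.sum_const_zero, add_zero]
    exact cx_add (cx_X _) (cx_X _)
  have hSc : complexity S ≤ complexity H + 6 := by
    have h1 : complexity (aeval g H) ≤ complexity H + 1 :=
      (complexity_aeval_le H g).trans (by omega)
    exact (cx_add (cx_X _) (cx_mul (cx_C _) (cx_mul (cx_X _)
      (cx_add h1 (cx_mul (cx_C _) (cx_X _)))))).trans (by omega)
  have hNc : ∀ z, complexity (N z) ≤ complexity z + (complexity H + 6) := fun z => by
    refine (complexity_aeval_le S _).trans ?_
    rw [Fintype.sum_option]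
    simp only [Option.elim_none, Option.elim_some, sum_cx_X, add_zero]
    omega
  have hiter : ∀ r, complexity (N^[r] (C (coeff 0 φ))) ≤ r * (complexity H + 6) := by
    intro r
    induction r with
    | zero => rw [Function.iterate_zero_apply, complexity_C_holds]; exact Nat.zero_le _
    | succ r ih =>
      rw [Function.iterate_succ_apply', add_mul, one_mul]; exact (hNc _).trans (by omega)
  have hsubc : ∀ j, ∑ v, complexity (sub j v) ≤ 2 * Fintype.card β := fun j => by
    have h1 : ∀ x : β, complexity (sub j (Sum.inl x)) ≤ 2 := fun x =>
      cx_mul (cx_C _) (cx_mul (cx_X _) (cx_X _))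
    have h2 : ∀ k, complexity (sub j (Sum.inr k)) = 0 := fun k => complexity_X_holds _
    rw [Fintype.sum_sum_type]; simp only [h2, Finset.sum_const_zero, add_zero]
    calc _ ≤ (univ : Finset β).card • 2 := Finset.sum_le_card_nsmul _ _ _ fun x _ => h1 x
      _ = 2 * Fintype.card β := by rw [Finset.card_univ, smul_eq_mul, mul_comm]
  have hEc : complexity E ≤ (d + 1) * (d * (complexity H + 6) + 2 * Fintype.card β + 2) := by
    have h1 : ∀ j, complexity (X (Sum.inr (some (some (some (some j))))) * aeval (sub j) zs) ≤
        d * (complexity H + 6) + 2 * Fintype.card β + 1 := fun j =>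
      (cx_mul (cx_X _) ((complexity_aeval_le zs (sub j)).trans
        (add_le_add (hiter d) (hsubc j)))).trans (by omega)
    have h2 := Finset.sum_le_card_nsmul univ _ _ fun j _ => h1 j
    rw [Finset.card_univ, Fintype.card_fin, smul_eq_mul] at h2
    have h3 := complexity_finset_sum_le (univ : Finset (Fin (d + 1)))
      fun j => X (Sum.inr (some (some (some (some j))))) * aeval (sub j) zs
    rw [Finset.card_univ, Fintype.card_fin] at h3
    exact h3.trans ((Nat.add_le_add_right h2 _).trans (le_of_eq (by ring)))
  have hgFc : ∑ o : Option β, complexity (gF o) ≤ 1 := by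
    have h0 : ∀ x : β, complexity (gF (some x)) = 0 := fun x => by
      show complexity (0 : MvPolynomial Unit F) = 0
      rw [← C_0]; exact complexity_C_holds _
    rw [Fintype.sum_option]; simp only [h0, Finset.sum_const_zero, add_zero]
    exact cx_add (cx_C _) (cx_X _)
  have hξFc : complexity ξF ≤ Ξ := by
    have h := complexity_pderiv_le none H
    rw [Fintype.card_option, show 3 * complexity H + (Fintype.card β + 1) + 1 =
      3 * complexity H + Fintype.card β + 2 from by ring] at h
    exact ((complexity_aeval_le _ gF).trans (add_le_add h hgFc)).trans hΞ
  have hcFc : complexity cF ≤ complexity H + 1 := (complexity_aeval_le H gF).trans (by omega)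
  have hXmc : complexity Xm ≤ 2 * μ := cx_X_pow_two_pow () μ
  have hPdc : complexity Pd ≤ 2 * μ + d := (cx_pow Xm d).trans (by omega)
  have hdenc : complexity den ≤ Ξ + (2 * μ + d) + 1 := cx_mul hξFc hPdc
  have ha0 : complexity (a none) ≤ 2 * μ + d + Ξ + 2 :=
    (cx_mul (cx_mul (cx_X ()) hPdc) hξFc).trans (by omega)
  have ha1 : complexity (a (some none)) ≤ 2 * μ + d := hPdc
  have ha2 : complexity (a (some (some none))) ≤ complexity H + 2 * μ + d + Ξ + 3 :=
    (cx_mul (cx_mul hcFc hPdc) hξFc).trans (by omega)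
  have ha3 : complexity (a (some (some (some none)))) ≤ 4 * μ + d + Ξ + 2 :=
    (cx_mul (cx_mul hXmc hPdc) hξFc).trans (by omega)
  have haℓ : ∀ j, complexity (a (some (some (some (some j))))) + 1 ≤ d * (2 * μ + 3) + Ξ + 3 :=
    fun j => by
    have h2 : (univ.erase j).card = d := by
      rw [Finset.card_erase_of_mem (mem_univ j), Finset.card_univ, Fintype.card_fin,
        Nat.add_sub_cancel]
    have h3 := Finset.sum_le_card_nsmul (univ.erase j)
      (fun i => complexity (C 1 + C (-lam i) * Xm : MvPolynomial Unit F)) (2 * μ + 2)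
      fun i _ => (cx_add (cx_C _) (cx_mul (cx_C _) hXmc)).trans (by omega)
    have h4 := complexity_finset_prod_le (univ.erase j)
      fun i => (C 1 + C (-lam i) * Xm : MvPolynomial Unit F)
    rw [h2, smul_eq_mul] at h3
    rw [h2] at h4
    have h5 := cx_mul (cx_mul (cx_C (π j)⁻¹) (h4.trans (Nat.add_le_add_right h3 d))) hξFc
    exact (Nat.add_le_add_right h5 1).trans (by linarith)
  have hsumℓ := Finset.sum_le_card_nsmul (univ : Finset (Fin (d + 1)))
    (fun j => complexity (a (some (some (some (some j))))) + 1) _ fun j _ => haℓ j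
  rw [Finset.card_univ, Fintype.card_fin, smul_eq_mul] at hsumℓ
  have hread : (∑ k, (complexity (a k) + 1)) + (complexity den + 1) ≤
      5 * (complexity H + 4 * μ + d + Ξ + 5) + (d + 1) * (d * (2 * μ + 3) + Ξ + 3) := by
    simp only [Fintype.sum_option]
    linarith
  have hEsq : 2 * (3 * complexity E + 2) ^ 2 ≤
      2 * (3 * ((d + 1) * (d * (complexity H + 6) + 2 * Fintype.card β + 2)) + 2) ^ 2 := by
    gcongr
  linarith

end Main

end Summit.ValiantsHypothesis.ValiantsHypothesis.Theorems.VPBoundarySquareRootsPresentable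

end
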